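import Summits.Ventures.PercRepro.C041TriDomDominationSeparable

/-!
# ROW C-041 — THE ANCHORED ORIENTATION: ITS CLASSES ARE DOMINATED, AND THE CONJECTURE HOLDS ON SEPARABLE HOSTS
(p6, gen 44; P6-TWOEXIT-LEAN.md §53 ADDENDUM 15, continued 2)

The ANCHORED orientation of the excess (§51–53: `RB = (s₁,s₂)`, `WRj = (s₂,s₃)`, `RWj = (s₁,s₃)`) has the crossed
classes `(s₁,s₂) ∪ (s₂,s₃) ∪ (s₁,s₃)` (`AncCrossed`; the cyclic one has `(s₃,s₁)` in place of `(s₁,s₃)`).  Its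
up-set conjecture `AncDomination` is the anchored twin of `CycDomination`, census-true on the same ≈ 2.8 × 10⁷
instances.  Here: the class `(s₁,s₃)` is dominated on every host (`class13_le_topBot`, the shape of
`class_le_of_shape` with the pair `(y, z)` and `W = {x ~_R y, x ≁_B y, x ≁_B z}`), so each anchored class is
dominated; the up-set form is equivalent to the red-ward injection (`ancDomination_iff_injection`), and
**THEOREM (ANCHORED STOCHASTIC DOMINATION ON SEPARABLE HOSTS)** (`ancDomination_of_separable`): on every separable
host the anchored conjecture holds — two classes empty, the third dominated, as for the cyclic orientation.
-/

namespace PercRepro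

namespace ZoneZ

namespace MultiExit

open ZoneData Finset

variable {V₁ E₁ U₁ U₂ : Type} (Z₁ : ZoneData V₁ E₁ U₁ U₂) (u u' a₁ : V₁)

/-- The anchored crossed classes `(s₁,s₂) ∪ (s₂,s₃) ∪ (s₁,s₃)` of the host with anchor `a₁` and exits `u, u'`. -/
def AncCrossed (ω : E₁ → Bool) : Prop :=
  (rsig Z₁ u u' a₁ (fun _ => EStat.free) ω = (true, false, false) ∧
      bsig Z₁ u u' a₁ (fun _ => EStat.free) ω = (false, true, false)) ∨
    (rsig Z₁ u u' a₁ (fun _ => EStat.free) ω = (false, true, false) ∧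
      bsig Z₁ u u' a₁ (fun _ => EStat.free) ω = (false, false, true)) ∨
    (rsig Z₁ u u' a₁ (fun _ => EStat.free) ω = (true, false, false) ∧
      bsig Z₁ u u' a₁ (fun _ => EStat.free) ω = (false, false, true))

variable [Fintype E₁] [DecidableEq E₁]

open Classical in
/-- **CONJECTURE (STOCHASTIC DOMINATION), anchored orientation**, up-set form: on every up-set of colourings the
anchored crossed classes are outnumbered by `(⊤, ⊥)`.  (A conjecture of the lane, stated, not asserted.) -/
def AncDomination : Prop :=
  ∀ V : (E₁ → Bool) → Prop, UpSet V →
    (univ.filter fun ω : E₁ → Bool => V ω ∧ AncCrossed Z₁ u u' a₁ ω).card ≤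
      (univ.filter fun ω : E₁ → Bool => V ω ∧ TopBot Z₁ a₁ u u' ω).card

open Classical in
/-- The anchored up-set form is equivalent to a red-ward injection of the anchored classes into `(⊤, ⊥)`. -/
theorem ancDomination_iff_injection :
    AncDomination Z₁ u u' a₁ ↔ ∃ φ : (E₁ → Bool) → (E₁ → Bool), Set.InjOn φ {ω | AncCrossed Z₁ u u' a₁ ω} ∧
      ∀ ω, AncCrossed Z₁ u u' a₁ ω → TopBot Z₁ a₁ u u' (φ ω) ∧ LeCol ω (φ ω) := by
  have key := monotone_injection_iff (univ.filter fun ω : E₁ → Bool => AncCrossed Z₁ u u' a₁ ω)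
    (univ.filter fun ω : E₁ → Bool => TopBot Z₁ a₁ u u' ω)
  constructor
  · intro h
    obtain ⟨φ, hinj, hφ⟩ := key.1 (fun V hV => by
      have h' := h V hV
      simp only [Finset.filter_filter]
      convert h' using 2 <;> · ext ω; simp only [Finset.mem_filter, Finset.mem_univ, true_and]; exact and_comm)
    refine ⟨φ, ?_, fun ω hω => ?_⟩
    · intro ω hω ω' hω' heq
      exact hinj (by simpa using hω) (by simpa using hω') heq
    · have := hφ ω (by simpa using hω)
      simpa using this
  · rintro ⟨φ, hinj, hφ⟩ V hV
    have h := key.2 ⟨φ, fun ω hω ω' hω' heq => hinj (by simpa using hω) (by simpa using hω') heq,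
      fun ω hω => by have := hφ ω (by simpa using hω); simpa using this⟩ V hV
    simp only [Finset.filter_filter] at h
    convert h using 2 <;> · ext ω; simp only [Finset.mem_filter, Finset.mem_univ, true_and]; exact and_comm

open Classical in
/-- **THE CLASS `(s₁,s₃)` IS DOMINATED**: `#{V ∧ (s₁,s₃)} ≤ #{V ∧ (⊤,⊥)}` on every up-set `V`. -/
theorem class13_le_topBot {V : (E₁ → Bool) → Prop} (hV : UpSet V) :
    (univ.filter fun ω : E₁ → Bool => V ω ∧ (rsig Z₁ u u' a₁ (fun _ => EStat.free) ω = (true, false, false) ∧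
      bsig Z₁ u u' a₁ (fun _ => EStat.free) ω = (false, false, true))).card ≤
      (univ.filter fun ω : E₁ → Bool => V ω ∧ TopBot Z₁ a₁ u u' ω).card := by
  let W : (E₁ → Bool) → Prop := fun ω => RdS Z₁ (fun _ => EStat.free) ω a₁ u ∧
    ¬ MgS Z₁ (fun _ => EStat.free) ω a₁ u ∧ ¬ MgS Z₁ (fun _ => EStat.free) ω a₁ u'
  have hW : UpSet W := fun ω ω' h hle =>
    ⟨RdS_mono Z₁ hle h.1, fun hb => h.2.1 (MgS_anti Z₁ hle hb), fun hb => h.2.2 (MgS_anti Z₁ hle hb)⟩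
  have hC : ∀ ω, (rsig Z₁ u u' a₁ (fun _ => EStat.free) ω = (true, false, false) ∧
      bsig Z₁ u u' a₁ (fun _ => EStat.free) ω = (false, false, true)) → W ω ∧ Z₁.Mg u u' ω ∧ ¬ Z₁.Rd u u' ω := by
    intro ω ⟨hr, hb⟩
    rw [rsig_eq_iff] at hr
    rw [bsig_eq_iff] at hb
    simp only [iff_true, Bool.false_eq_true, iff_false] at hr hb
    refine ⟨⟨hr.1, hb.1, hb.2.1⟩, ?_, ?_⟩
    · exact (MgS_free Z₁ ω u u').1 hb.2.2
    · exact fun h => hr.2.2 ((RdS_free Z₁ ω u u').2 h)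
  have hT : ∀ ω, W ω → Z₁.Rd u u' ω → ¬ Z₁.Mg u u' ω → TopBot Z₁ a₁ u u' ω := by
    intro ω ⟨h1, h2, h3⟩ hR hM
    unfold TopBot
    rw [rsig_eq_iff, bsig_eq_iff]
    simp only [iff_true, Bool.false_eq_true, iff_false]
    have hR' := (RdS_free Z₁ ω u u').2 hR
    have hM' : ¬ MgS Z₁ (fun _ => EStat.free) ω u u' := fun h => hM ((MgS_free Z₁ ω u u').1 h)
    exact ⟨⟨h1, RdS_trans' Z₁ h1 hR', hR'⟩, h2, h3, hM'⟩
  have h := class_le_of_shape Z₁ u u' a₁ u u' _ W hW hC hT hV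
  convert h

omit [Fintype E₁] [DecidableEq E₁] in
/-- With two coincident marks no colouring is anchored-crossed. -/
theorem not_ancCrossed_of_coinc (h : a₁ = u ∨ a₁ = u' ∨ u = u') (ω : E₁ → Bool) :
    ¬ AncCrossed Z₁ u u' a₁ ω := by
  intro hc
  unfold AncCrossed at hc
  rcases hc with ⟨hr, hb⟩ | ⟨hr, hb⟩ | ⟨hr, hb⟩ <;> rw [rsig_eq_iff] at hr <;> rw [bsig_eq_iff] at hb <;>
    simp only [iff_true, Bool.false_eq_true, iff_false] at hr hb <;> rcases h with rfl | rfl | rfl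
  · exact hb.1 (mem_reach_self _ _)
  · exact hr.2.1 (mem_reach_self _ _)
  · exact hr.2.2 (mem_reach_self _ _)
  · exact hr.1 (mem_reach_self _ _)
  · exact hb.2.1 (mem_reach_self _ _)
  · exact hr.2.2 (mem_reach_self _ _)
  · exact hb.1 (mem_reach_self _ _)
  · exact hr.2.1 (mem_reach_self _ _)
  · exact hr.2.2 (mem_reach_self _ _)

open Classical in
/-- The anchored count inside `V` is at most the count of one class `C` when the other two are empty on `V`. -/
theorem card_ancCrossed_le_of_two_empty (C : (E₁ → Bool) → Prop) {V : (E₁ → Bool) → Prop}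
    (h : ∀ ω, V ω → AncCrossed Z₁ u u' a₁ ω → C ω) :
    (univ.filter fun ω : E₁ → Bool => V ω ∧ AncCrossed Z₁ u u' a₁ ω).card ≤
      (univ.filter fun ω : E₁ → Bool => V ω ∧ C ω).card := by
  refine Finset.card_le_card fun ω hω => ?_
  obtain ⟨hu, hV, hc⟩ := Finset.mem_filter.mp hω
  exact Finset.mem_filter.mpr ⟨hu, hV, h ω hV hc⟩

open Classical in
/-- With two coincident marks the anchored conjecture holds trivially. -/
theorem ancDomination_of_coinc (h : a₁ = u ∨ a₁ = u' ∨ u = u') : AncDomination Z₁ u u' a₁ := by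
  intro V _
  refine le_trans (card_ancCrossed_le_of_two_empty Z₁ u u' a₁ (fun _ => False) fun ω _ hc =>
    not_ancCrossed_of_coinc Z₁ u u' a₁ h ω hc) ?_
  simp

open Classical in
/-- **THEOREM (ANCHORED STOCHASTIC DOMINATION ON SEPARABLE HOSTS)**: on a separable host (coincidences included)
the anchored up-set conjecture holds. -/
theorem ancDomination_of_separable (h : SeparableS Z₁ u u' a₁ (fun _ => EStat.free)) :
    AncDomination Z₁ u u' a₁ := by
  rcases h with h | h | h | h
  · -- not all connected: every class is empty
    intro V _
    refine le_trans (card_ancCrossed_le_of_two_empty Z₁ u u' a₁ (fun _ => False) fun ω _ hc => ?_) ?_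
    · exfalso
      apply h
      unfold AncCrossed at hc
      rcases hc with ⟨hr, hb⟩ | ⟨hr, hb⟩ | ⟨hr, hb⟩ <;> rw [rsig_eq_iff] at hr <;> rw [bsig_eq_iff] at hb <;>
        simp only [iff_true, Bool.false_eq_true, iff_false] at hr hb
      · exact ⟨RdS_pconn Z₁ hr.1, MgS_pconn Z₁ hb.2.1⟩
      · exact ⟨PConn_trans Z₁ (RdS_pconn Z₁ hr.2.1) (PConn_symm Z₁ (MgS_pconn Z₁ hb.2.2)), RdS_pconn Z₁ hr.2.1⟩
      · exact ⟨RdS_pconn Z₁ hr.1, PConn_trans Z₁ (RdS_pconn Z₁ hr.1) (MgS_pconn Z₁ hb.2.2)⟩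
    · simp
  · -- `a₁` separates `u` from `u'`: only `(s₁,s₂)` survives
    unfold SepS at h
    rcases h with h | h | hside
    · exact ancDomination_of_coinc Z₁ u u' a₁ (Or.inl h.symm)
    · exact ancDomination_of_coinc Z₁ u u' a₁ (Or.inr (Or.inl h.symm))
    intro V hV
    by_cases hu'a : u' = a₁
    · exact ancDomination_of_coinc Z₁ u u' a₁ (Or.inr (Or.inl hu'a.symm)) V hV
    refine le_trans (card_ancCrossed_le_of_two_empty Z₁ u u' a₁
      (fun ω => rsig Z₁ u u' a₁ (fun _ => EStat.free) ω = (true, false, false) ∧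
        bsig Z₁ u u' a₁ (fun _ => EStat.free) ω = (false, true, false)) fun ω _ hc => ?_) ?_
    swap
    · convert class12_le_topBot Z₁ u u' a₁ hV
      rfl
    unfold AncCrossed at hc
    rcases hc with hc | ⟨hr, hb⟩ | ⟨hr, hb⟩
    · exact hc
    · exfalso
      rw [rsig_eq_iff] at hr
      rw [bsig_eq_iff] at hb
      simp only [iff_true, Bool.false_eq_true, iff_false] at hr hb
      exact hb.1 (MgS_symm' Z₁ (MgS_through_of_sep Z₁ hu'a hside hb.2.2))
    · exfalso
      rw [rsig_eq_iff] at hr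
      rw [bsig_eq_iff] at hb
      simp only [iff_true, Bool.false_eq_true, iff_false] at hr hb
      exact hb.1 (MgS_symm' Z₁ (MgS_through_of_sep Z₁ hu'a hside hb.2.2))
  · -- `u` separates `a₁` from `u'`: only `(s₁,s₃)` survives
    unfold SepS at h
    rcases h with h | h | hside
    · exact ancDomination_of_coinc Z₁ u u' a₁ (Or.inl h)
    · exact ancDomination_of_coinc Z₁ u u' a₁ (Or.inr (Or.inr h.symm))
    intro V hV
    by_cases hu'u : u' = u
    · exact ancDomination_of_coinc Z₁ u u' a₁ (Or.inr (Or.inr hu'u.symm)) V hV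
    refine le_trans (card_ancCrossed_le_of_two_empty Z₁ u u' a₁
      (fun ω => rsig Z₁ u u' a₁ (fun _ => EStat.free) ω = (true, false, false) ∧
        bsig Z₁ u u' a₁ (fun _ => EStat.free) ω = (false, false, true)) fun ω _ hc => ?_) ?_
    swap
    · convert class13_le_topBot Z₁ u u' a₁ hV
      rfl
    unfold AncCrossed at hc
    rcases hc with ⟨hr, hb⟩ | ⟨hr, hb⟩ | hc
    · exfalso
      rw [rsig_eq_iff] at hr
      rw [bsig_eq_iff] at hb
      simp only [iff_true, Bool.false_eq_true, iff_false] at hr hb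
      exact hb.1 (MgS_through_of_sep Z₁ hu'u hside hb.2.1)
    · exfalso
      rw [rsig_eq_iff] at hr
      rw [bsig_eq_iff] at hb
      simp only [iff_true, Bool.false_eq_true, iff_false] at hr hb
      exact hr.1 (RdS_through_of_sep Z₁ hu'u hside hr.2.1)
    · exact hc
  · -- `u'` separates `a₁` from `u`: only `(s₂,s₃)` survives
    unfold SepS at h
    rcases h with h | h | hside
    · exact ancDomination_of_coinc Z₁ u u' a₁ (Or.inr (Or.inl h))
    · exact ancDomination_of_coinc Z₁ u u' a₁ (Or.inr (Or.inr h))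
    intro V hV
    by_cases huu' : u = u'
    · exact ancDomination_of_coinc Z₁ u u' a₁ (Or.inr (Or.inr huu')) V hV
    refine le_trans (card_ancCrossed_le_of_two_empty Z₁ u u' a₁
      (fun ω => rsig Z₁ u u' a₁ (fun _ => EStat.free) ω = (false, true, false) ∧
        bsig Z₁ u u' a₁ (fun _ => EStat.free) ω = (false, false, true)) fun ω _ hc => ?_) ?_
    swap
    · convert class23_le_topBot Z₁ u u' a₁ hV
      rfl
    unfold AncCrossed at hc
    rcases hc with ⟨hr, hb⟩ | hc | ⟨hr, hb⟩
    · exfalso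
      rw [rsig_eq_iff] at hr
      rw [bsig_eq_iff] at hb
      simp only [iff_true, Bool.false_eq_true, iff_false] at hr hb
      exact hr.2.1 (RdS_through_of_sep Z₁ huu' hside hr.1)
    · exact hc
    · exfalso
      rw [rsig_eq_iff] at hr
      rw [bsig_eq_iff] at hb
      simp only [iff_true, Bool.false_eq_true, iff_false] at hr hb
      exact hr.2.1 (RdS_through_of_sep Z₁ huu' hside hr.1)

end MultiExit

end ZoneZ

end PercRepro
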